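import Summits.HodgeConjecture.HodgeConjecture.Theses.DerivedTorelliFermat
import Literature.AlgebraicGeometry.HodgeTheory.FermatShiodaCondition

/-!
# Route DerivedTorelliFermat — `ThirtyThreeGlue` (glue item stmt-HodgeConjecture-14298)

`FermatFourfoldsHCModResidual → ResidualCensusBelow110 → FermatFourfoldThirtyThree`: at degree
`m = 33 < 110` the census says every Hodge sextuple of residues is Shioda–Aoki decomposable or of K3
type (the third census alternative needs `m = 70`), so the residual hypothesis of
`FermatFourfoldsHCModResidual` at `m = 33` is vacuous and the Hodge conjecture for the Fermat
fourfolds of degree `33` follows.  The multiset of values of a Hodge character is a Hodge multiset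
(`FermatCharacter.IsHodge.isHodgeMultiset`) of cardinality `6`.  No named-fact hypothesis, no sorry.
-/

-- `Summit.HodgeConjecture.HodgeConjecture.Theorems` is the mandated namespace (single-problem
-- summit: Problem = Summit), which `linter.dupNamespace` flags on every declaration; the lakefile
-- turns the linter off tree-wide (weak option), restated here so stand-alone elaboration is
-- warning-free too.
set_option linter.dupNamespace false

namespace Summit.HodgeConjecture.HodgeConjecture.Theorems

open Literature.AlgebraicGeometry.HodgeTheory

/-- **Item stmt-HodgeConjecture-14298 (`ThirtyThreeGlue`), route `DerivedTorelliFermat`**: the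
residual sector is empty at `m = 33` by the census below `110`, so `FermatFourfoldsHCModResidual`
gives the Hodge conjecture for Fermat fourfolds of degree `33`. [cite: Shioda1979PJA, §1 and §2 Thm. 1] -/
theorem derivedTorelliFermat_thirtyThreeGlue_proof :
    Summit.HodgeConjecture.HodgeConjecture.Theses.DerivedTorelliFermat.ThirtyThreeGlue := by
  intro hMod hCensus X hF hX
  refine hMod 33 (fun α hα hndec hnK3 ↦ ?_) X hF hX
  exfalso
  have hcard : Multiset.card (Finset.univ.val.map α) = 6 := by simp
  rcases hCensus 33 (by norm_num) (Finset.univ.val.map α) hα.isHodgeMultiset hcard with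
    hdec | hK3 | ⟨h70, -⟩
  · exact hndec hdec
  · exact hnK3 hK3
  · norm_num at h70

end Summit.HodgeConjecture.HodgeConjecture.Theorems
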